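import Mathlib
import HarnessLib
import Summits.CriticalPhenomena.CardyFormulaZ2.Theorems.CardyMagicRigidityMagicFormulaTSplit
import Summits.CriticalPhenomena.CardyFormulaZ2.Theorems.CardyMagicRigidityMagicFormulaTThirdOrderReduction
import Summits.CriticalPhenomena.CardyFormulaZ2.Theorems.CardyMagicRigidityTransferContinuityReduction
import Literature.Probability.RandomPlanarGeometry.NestingTransform
import Literature.Probability.Percolation.FullPlaneCNL
import Literature.Probability.Percolation.TriCorrLengthExponentDecomposition

/-!
# Line `Sketch` for crux `MagicFormulaT`, sub-goal `threePoint_existsLimit_of_facts`: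
# the three-point power-sum expectation has a limit, modulo the published inputs

Crux `Summit.CriticalPhenomena.CardyFormulaZ2.Theses.CardyMagicRigidity.MagicFormulaT`
(stmt-CriticalPhenomena-4836), line `Sketch`, wave-1 sub-goal of lead c5.

For an admissible density `f` (`|f| ≤ C`, `f = 0` off `B̄(0, R)`, `∫ f = 0`) put `θ_u = u.nestingPhase f`,
`A_m = Σ_u θ_u^m` (loops `u` of `siteLoopConfig δ ω`) and `Φ_δ(t) = E_{1/2}[∏_u 2cos(t θ_u + π/3)]`
(`t ∈ ℂ`).  **Claim.**  Granting Camia–Newman's full-plane CLE₆ limit (`exists_isFullPlaneCNLLaw`) and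
Smirnov–Werner's four-arm exponent (`SmirnovWerner2001_fourArm_scalingLimit`), the order-3 power-sum
expectation `E_{1/2}[3A₁³ − 12A₁A₂ + 8A₃]` has a (real) limit as the mesh `δ ↓ 0`.

Proof.  The two published inputs give a complex limit `a` of the third Taylor coefficient `Φ_δ'''(0)`
(`Split.coeffLimitsExistT_of_facts` at `k = 3`, its untyped interface-loop set being
`(siteLoopConfig δ ω).loops` by `Theorems.loops_siteLoopConfig` and its phase `u.nestingPhase f` by
definition).  At every positive mesh `Φ_δ'''(0) = −√3 · E_{1/2}[3A₁³ − 12A₁A₂ + 8A₃]` (as a real number cast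
to `ℂ`, `ho_iteratedDeriv_three_eq`), hence eventually along `𝓝[>] 0`; taking real parts,
`−√3 · E_δ → a.re`, and dividing by `−√3 ≠ 0` the witness is `L = a.re / (−√3)`.
The named facts enter only as hypotheses; no definition is introduced.
-/

noncomputable section

namespace Summit.CriticalPhenomena.CardyFormulaZ2.Cruxes.MagicFormulaT.LineSketch

open MeasureTheory Filter Set
open scoped Real Topology BigOperators ENNReal
open Literature.Probability.RandomPlanarGeometry Literature.Probability.Percolation
  Literature.Probability.LatticeModels
open Summit.CriticalPhenomena.CardyFormulaZ2.Theorems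

/-- **Real limits from complex ones.**  If `F → a` in `ℂ` along a filter and eventually
`F i = ↑(c · E i)` for a real constant `c ≠ 0` and a real family `E`, then `E → a.re / c`:
take real parts (`Complex.continuous_re`, `Complex.ofReal_re`) and divide by `c`. -/
theorem tel_tendsto_of_ofReal_const_mul {ι : Type*} {l : Filter ι} {E : ι → ℝ} {F : ι → ℂ} {c : ℝ}
    {a : ℂ} (hc : c ≠ 0) (hF : Tendsto F l (𝓝 a)) (hev : ∀ᶠ i in l, ((c * E i : ℝ) : ℂ) = F i) :
    Tendsto E l (𝓝 (a.re / c)) := by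
  have h1 : Tendsto (fun i ↦ ((c * E i : ℝ) : ℂ)) l (𝓝 a) := hF.congr' (hev.mono fun i hi ↦ hi.symm)
  have h2 : Tendsto (fun i ↦ c * E i) l (𝓝 a.re) := by
    have key := (Complex.continuous_re.tendsto a).comp h1
    simp only [Function.comp_def, Complex.ofReal_re] at key
    exact key
  have h3 := h2.div_const c
  simp only [mul_div_cancel_left₀ _ hc] at h3
  exact h3

/-- **Sub-goal `threePoint_existsLimit_of_facts` · the three-point power-sum expectation converges, modulo
the published inputs.**  Granting `exists_isFullPlaneCNLLaw` (Camia–Newman 2006) and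
`SmirnovWerner2001_fourArm_scalingLimit` (Smirnov–Werner 2001), for every admissible `f` the expectation
`E_{1/2}[3A₁³ − 12A₁A₂ + 8A₃]` (`A_m = Σ_u θ_u(f)^m` over the loops of `siteLoopConfig δ ω`) has a limit
`L ∈ ℝ` as `δ ↓ 0`: the third Taylor coefficient `Φ_δ'''(0)` of the complex-coupling nesting transform has a
limit `a` (`Split.coeffLimitsExistT_of_facts`, `k = 3`, through `loops_siteLoopConfig`), equals
`↑(−√3 · E_δ[…])` at every positive mesh (`ho_iteratedDeriv_three_eq`), and `L = a.re / (−√3)`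
(`tel_tendsto_of_ofReal_const_mul`). -/
theorem threePoint_existsLimit_of_facts : exists_isFullPlaneCNLLaw → SmirnovWerner2001_fourArm_scalingLimit →
    ∀ (f : ℂ → ℝ) (R C : ℝ), Measurable f → (∀ z, |f z| ≤ C) → (∀ z, R < ‖z‖ → f z = 0) → ∫ z, f z = 0 →
    ∃ L : ℝ, Tendsto (fun δ : ℝ ↦ ∫ ω, (3 * (∑ᶠ u ∈ (siteLoopConfig δ ω).loops, u.nestingPhase f) ^ 3 -
      12 * (∑ᶠ u ∈ (siteLoopConfig δ ω).loops, u.nestingPhase f) *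
        (∑ᶠ u ∈ (siteLoopConfig δ ω).loops, u.nestingPhase f ^ 2) +
      8 * (∑ᶠ u ∈ (siteLoopConfig δ ω).loops, u.nestingPhase f ^ 3)) ∂(triSitePercolation half))
      (𝓝[>] (0 : ℝ)) (𝓝 L) := by
  intro hCN hSW f R C hf hC hR h0
  -- the complex limit of the third Taylor coefficient, in the vocabulary of line `Sketch`
  obtain ⟨a, ha⟩ := Split.coeffLimitsExistT_of_facts hCN hSW f R C hf hC hR h0 3
  simp_rw [← loops_siteLoopConfig] at ha
  have hphase : ∀ u : UnbasedLoop ℂ, (∫ z in {z : ℂ | u.wind z ≠ 0}, f z) = u.nestingPhase f := fun u ↦ rfl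
  simp_rw [hphase] at ha
  -- at every positive mesh the coefficient is `↑(−√3 · E_δ[3A₁³ − 12A₁A₂ + 8A₃])`
  have hsqrt : (-Real.sqrt 3 : ℝ) ≠ 0 :=
    neg_ne_zero.2 (Real.sqrt_ne_zero'.2 (by norm_num))
  exact ⟨a.re / (-Real.sqrt 3), tel_tendsto_of_ofReal_const_mul hsqrt ha
    (eventually_nhdsWithin_of_forall fun δ hδ ↦ (ho_iteratedDeriv_three_eq hf hC hR h0 hδ).symm)⟩

end Summit.CriticalPhenomena.CardyFormulaZ2.Cruxes.MagicFormulaT.LineSketch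

end
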